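import Literature.IUT.HodgeTheaters.TemperedCoveringsCor23LevelsSub
import Literature.AnabelianGeometry.SemiGraphs.SubgraphReachabilityTransport
import HarnessLib

/-!
# [IUTchI] Cor. 2.3 at the levels: the B4 combinatorial core AT THE SEMI-GRAPH-COVERING INSTANTIATION

Mochizuki, *Inter-universal Teichmüller theory I*, kurims manuscript (May 2020), §2, Cor. 2.3 pp. 47–49 and
the levels `𝔾_J` of the proof of Prop. 2.4 (i), p. 50 l. 27–42 ([IUTchI] Cor 2.3 pp.47-49)
[claim: Mochizuki2012, status: disputed]; consumed at *Inter-universal Teichmüller theory II* (Dec. 2020) Cor. 2.4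
(i), proof p. 70 l. −2 – p. 71 l. 3 ("by applying … [IUTchI], Corollary 2.3, (vi) [cf. also [CombGC],
Proposition 1.2, (ii)], to the various finite index open subgroups of `Δ^±_v`, it follows that
`γ′ ∈ Δ̂^±_{v□}`").  The combinatorial half of that sentence — «distinct connected components of `p_i⁻¹(□)` are
disjoint and are permuted by the covering group, so an element moving one vertex of a component into the
component stabilises it» — is [SemiAnbd] §1 semi-graph theory (Mochizuki, *Semi-graphs of anabelioids*,
Publ. RIMS **42** (2006), §1 pp. 11–13, Lemma 1.8 p. 20: actions `Γ → Aut G`)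
[cite: MochizukiSemiAnbd2006, §1 pp.11-13].

abc-iut cell, sub-DAG plan/L5/SUBDAG-IUTchI-Cor23Levels.md, row «B4 core» (abc-iut-L3-lead α9-5 assignment
to seat abc-iut-w4-d076), over abc-iut-L5-t11's carrier `Prop24Tower.SubgraphLevelData`
(`TemperedCoveringsCor23LevelsSub.lean`, p418158), whose B4-core predicates `CompsDisjoint` / `CompsInvariant`
are stated over ABSTRACT level data (`Vtx i`, `act i`, `comps i`, …).  Here:

* `CoveringLevelGraphs T` — the SEMI-GRAPH-COVERING REALISATION of that data (the "TODO-merge: specialisation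
  datum per finite étale cover" of the carrier's docstring): a base semi-graph `𝔾` with the sub-semi-graph
  `ℍ`, for each level `i` the semi-graph `𝔾_{J_i}` with its projection `p_i : 𝔾_{J_i} → 𝔾`, the action of
  `Π^tp_X` on `𝔾_{J_i}` by semi-graph automorphisms OVER `p_i` (deck transformations), a vertex `c_i` over `ℍ`
  (through which `ℍ̃_i` passes) and the cusp-vertices; pure data + the one law «`p_i ∘ t = p_i`»;
* `CoveringLevelGraphs.toLevelData : T.SubgraphLevelData` — `Vtx i :=` vertices of `𝔾_{J_i}`, `act i :=` the
  induced permutation of vertices (`SemiGraph.autVertexPerm`), `comps i :=` the connected components of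
  `p_i⁻¹(ℍ)` as vertex sets (reachability classes of the barycentric subdivision of the preimage
  sub-semi-graph, [SemiAnbd] §1 p. 12), `compH i :=` the component through `c_i`;
* **PROVED**: `toLevelData_compsDisjoint` (B4 core (i)), `toLevelData_compsInvariant` (B4 core (ii): from
  `SemiGraph.preimage_reachable_inl_aut_iff`, deck transformations permute the components),
  `toLevelData_isBlock`, and `toLevelData_levelActsTrivially` (B1 (a) from the kernel hypothesis
  «`J_i` acts trivially on `𝔾_{J_i}`»).

So at the semi-graph-covering instantiation the carrier's residual {`CompsDisjoint`, `CompsInvariant`} is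
DISCHARGED; the dictionary rows B1 (b)(c) (`DeltaHStabilizes`, `StabLeDeltaHLevel`: decomposition groups ↔
stabilisers) and B3 (`LevelIncidence`) are NOT touched here (they are not combinatorics).  No instance, no
notation, no new Literature FACT; nothing here bears on [IUTchIII] Cor. 3.12 or takes a side; typed ≠ discharged.
-/

namespace Literature.AnabelianGeometry.SemiGraphs

namespace SemiGraph

open CategoryTheory

universe u

variable (G : SemiGraph.{u})

/-- The action of the automorphism group of a semi-graph on its vertices, as a homomorphism
`Aut G → Sym(𝒱)` ([SemiAnbd] Lemma 1.8 p. 20: a group acting on `G` acts on its vertices).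
[cite: MochizukiSemiAnbd2006, Lem. 1.8 p.20] -/
def autVertexPerm : Aut G →* Equiv.Perm G.Vertex where
  toFun σ :=
    { toFun := σ.hom.vertexMap
      invFun := σ.inv.vertexMap
      left_inv := inv_vertexMap_hom_vertexMap σ
      right_inv := inv_vertexMap_hom_vertexMap σ.symm }
  map_one' := rfl
  map_mul' _ _ := rfl

/-- `autVertexPerm σ v = σ v`. [cite: MochizukiSemiAnbd2006, Lem. 1.8 p.20] -/
@[simp] theorem autVertexPerm_apply (σ : Aut G) (v : G.Vertex) :
    G.autVertexPerm σ v = σ.hom.vertexMap v := rfl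

end SemiGraph

end Literature.AnabelianGeometry.SemiGraphs

namespace Literature.IUT.HodgeTheaters

open CategoryTheory
open Literature.AnabelianGeometry.SemiGraphs

universe u

namespace StableCurveTemperedData

variable {D : StableCurveTemperedData.{u}}

namespace Prop24Tower

variable (T : D.Prop24Tower)

/-! ### The semi-graph-covering realisation of the level data -/

/-- **The levels as coverings of semi-graphs with deck transformations** ([IUTchI] p. 50 l. 27–30: "`J ⊆ Δ^tp_X`
… `𝔾_J` the pro-`Σ` semi-graph of anabelioids associated to the special fiber of the stable model … of the
finite étale covering of `X ×_k k̄` determined by `J`"; here only the UNDERLYING SEMI-GRAPHS are recorded): the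
dual semi-graph `𝔾` of the special fibre of `X` with the `G_k`-stable sub-semi-graph `ℍ` (p. 47), for every level
`i` the dual semi-graph `𝔾_{J_i}` with its projection `p_i` to `𝔾`, the action of `Π^tp_X` on `𝔾_{J_i}` by
automorphisms of semi-graphs lying OVER `p_i` (the covering `X_{J_i} → X` is Galois), a vertex `c_i` over `ℍ`
(the component `ℍ̃_i` is the one through `c_i`), and for each cusp `x` of `X` the vertex of `𝔾_{J_i}` met by the
cusp of `X_{J_i}` under the pro-cusp `x̃`.  Data + the one law `act_over`; nothing else is asserted.
[cite: Mochizuki2012, Prop 2.4(i) p.50] -/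
structure CoveringLevelGraphs : Type (u + 1) where
  /-- the dual semi-graph `𝔾` of the special fibre of (the stable model of) `X` -/
  base : SemiGraph.{u}
  /-- the sub-semi-graph `ℍ ⊆ 𝔾` -/
  H : base.Subgraph
  /-- the dual semi-graph `𝔾_{J_i}` of the special fibre of `X_{J_i}` -/
  graph : T.I → SemiGraph.{u}
  /-- the projection `p_i : 𝔾_{J_i} → 𝔾` -/
  proj : ∀ i, graph i ⟶ base
  /-- the action of `Π^tp_X` on `𝔾_{J_i}` by automorphisms of semi-graphs -/
  act : ∀ i, D.PiTp →* Aut (graph i)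
  /-- the action is by deck transformations: it lies over `p_i` -/
  act_over : ∀ i (t : D.PiTp), (act i t).hom ≫ proj i = proj i
  /-- a vertex `c_i` of `𝔾_{J_i}` through which the distinguished component `ℍ̃_i` passes … -/
  ctr : ∀ i, (graph i).Vertex
  /-- … lying over `ℍ` -/
  ctr_mem : ∀ i, (proj i).vertexMap (ctr i) ∈ H.verts
  /-- the vertex of `𝔾_{J_i}` met by the cusp of `X_{J_i}` under the pro-cusp `x̃` of the cusp `x` -/
  vtxCusp : ∀ i, D.Cusp → (graph i).Vertex

namespace CoveringLevelGraphs

variable {T} (C : T.CoveringLevelGraphs)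

/-- The inverse image `p_i⁻¹(ℍ) ⊆ 𝔾_{J_i}` as a sub-semi-graph. [cite: Mochizuki2012, Cor 2.3 p.47] -/
def preimageH (i : T.I) : (C.graph i).Subgraph :=
  ⟨(C.proj i).vertexMap ⁻¹' C.H.verts, (C.proj i).edgeMap ⁻¹' C.H.edges⟩

/-- The connected component of `p_i⁻¹(ℍ)` through a vertex `v` over `ℍ`, as a set of vertices of `𝔾_{J_i}`:
the vertices joined to `v` by a walk of the barycentric subdivision of `p_i⁻¹(ℍ)` ([SemiAnbd] §1 pp. 11–12).
[cite: MochizukiSemiAnbd2006, §1 p.12] -/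
def compOf (i : T.I) (v : (C.graph i).Vertex) (hv : (C.proj i).vertexMap v ∈ C.H.verts) :
    Set (C.graph i).Vertex :=
  {u | ∃ hu : (C.proj i).vertexMap u ∈ C.H.verts,
    (C.preimageH i).toSemiGraph.subdivision.Reachable (Sum.inl ⟨v, hv⟩) (Sum.inl ⟨u, hu⟩)}

/-- Membership in `compOf`. [cite: MochizukiSemiAnbd2006, §1 p.12] -/
theorem mem_compOf_iff (i : T.I) (v : (C.graph i).Vertex) (hv : (C.proj i).vertexMap v ∈ C.H.verts)
    (u : (C.graph i).Vertex) :
    u ∈ C.compOf i v hv ↔ ∃ hu : (C.proj i).vertexMap u ∈ C.H.verts,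
      (C.preimageH i).toSemiGraph.subdivision.Reachable (Sum.inl ⟨v, hv⟩) (Sum.inl ⟨u, hu⟩) :=
  Iff.rfl

/-- `v` lies in its own component. [cite: MochizukiSemiAnbd2006, §1 p.12] -/
theorem mem_compOf_self (i : T.I) (v : (C.graph i).Vertex) (hv : (C.proj i).vertexMap v ∈ C.H.verts) :
    v ∈ C.compOf i v hv :=
  ⟨hv, SimpleGraph.Reachable.refl _⟩

/-- Two components with a common vertex coincide (reachability is an equivalence relation).
[cite: MochizukiSemiAnbd2006, §1 p.12] -/
theorem compOf_eq_of_mem (i : T.I) {v w : (C.graph i).Vertex} (hv : (C.proj i).vertexMap v ∈ C.H.verts)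
    (hw : (C.proj i).vertexMap w ∈ C.H.verts) {x : (C.graph i).Vertex} (hxv : x ∈ C.compOf i v hv)
    (hxw : x ∈ C.compOf i w hw) : C.compOf i v hv = C.compOf i w hw := by
  obtain ⟨hx, hvx⟩ := hxv
  obtain ⟨_, hwx⟩ := hxw
  have hvw := hvx.trans hwx.symm
  ext u
  constructor
  · rintro ⟨hu, hvu⟩
    exact ⟨hu, hvw.symm.trans hvu⟩
  · rintro ⟨hu, hwu⟩
    exact ⟨hu, hvw.trans hwu⟩

/-- **Deck transformations carry components to components**: the image of the component through `v` under
`t ∈ Π^tp_X` is the component through `t·v`. [cite: MochizukiSemiAnbd2006, Lem. 1.8 p.20] -/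
theorem image_compOf (i : T.I) (t : D.PiTp) (v : (C.graph i).Vertex) (hv : (C.proj i).vertexMap v ∈ C.H.verts) :
    (C.act i t).hom.vertexMap '' C.compOf i v hv =
      C.compOf i ((C.act i t).hom.vertexMap v)
        (SemiGraph.preimage_verts_aut (C.proj i) C.H (C.act i t) (C.act_over i t) v hv) := by
  have hσ := C.act_over i t
  ext u'
  constructor
  · rintro ⟨u, ⟨hu, hvu⟩, rfl⟩
    exact ⟨SemiGraph.preimage_verts_aut (C.proj i) C.H (C.act i t) hσ u hu,
      (SemiGraph.preimage_reachable_inl_aut_iff (C.proj i) C.H (C.act i t) hσ hv hu).mpr hvu⟩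
  · rintro ⟨hu', hvu'⟩
    -- `u' = t · u` with `u := t⁻¹ · u'`
    have hσi : ((C.act i t)⁻¹).hom ≫ C.proj i = C.proj i :=
      SemiGraph.Aut.inv_comp_eq_of_hom_comp_eq (C.proj i) (C.act i t) hσ
    have hu : (C.proj i).vertexMap ((C.act i t).inv.vertexMap u') ∈ C.H.verts :=
      SemiGraph.preimage_verts_aut (C.proj i) C.H (C.act i t)⁻¹ hσi u' hu'
    have e : (C.act i t).hom.vertexMap ((C.act i t).inv.vertexMap u') = u' :=
      SemiGraph.inv_vertexMap_hom_vertexMap (C.act i t).symm u'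
    refine ⟨(C.act i t).inv.vertexMap u', ⟨hu, ?_⟩, e⟩
    apply (SemiGraph.preimage_reachable_inl_aut_iff (C.proj i) C.H (C.act i t) hσ hv hu).mp
    have e1 : (⟨(C.act i t).hom.vertexMap ((C.act i t).inv.vertexMap u'),
        SemiGraph.preimage_verts_aut (C.proj i) C.H (C.act i t) hσ _ hu⟩ :
          (C.preimageH i).toSemiGraph.Vertex) = ⟨u', hu'⟩ := Subtype.ext e
    have key : (C.preimageH i).toSemiGraph.subdivision.Reachable
        (Sum.inl ⟨(C.act i t).hom.vertexMap v,
          SemiGraph.preimage_verts_aut (C.proj i) C.H (C.act i t) hσ v hv⟩)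
        (Sum.inl ⟨(C.act i t).hom.vertexMap ((C.act i t).inv.vertexMap u'),
          SemiGraph.preimage_verts_aut (C.proj i) C.H (C.act i t) hσ _ hu⟩) := by
      rw [e1]; exact hvu'
    exact key

/-- **The level data of the carrier, realised by the coverings of semi-graphs**: vertices of `𝔾_{J_i}` with the
induced permutation action, the connected components of `p_i⁻¹(ℍ)` as vertex sets, the component `ℍ̃_i`
through `c_i`, and the cusp-vertices. [cite: Mochizuki2012, Prop 2.4(i) p.50] -/
def toLevelData : T.SubgraphLevelData where
  Vtx i := (C.graph i).Vertex
  act i := (SemiGraph.autVertexPerm (C.graph i)).comp (C.act i)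
  comps i := {A | ∃ (v : (C.graph i).Vertex) (hv : (C.proj i).vertexMap v ∈ C.H.verts), A = C.compOf i v hv}
  compH i := C.compOf i (C.ctr i) (C.ctr_mem i)
  compH_mem i := ⟨C.ctr i, C.ctr_mem i, rfl⟩
  vtxCusp := C.vtxCusp

/-- The action of the realised level data on a vertex is the deck transformation.
[cite: Mochizuki2012, Prop 2.4(i) p.50] -/
@[simp] theorem toLevelData_act_apply (i : T.I) (t : D.PiTp) (v : (C.graph i).Vertex) :
    C.toLevelData.act i t v = (C.act i t).hom.vertexMap v := rfl

/-- **B4 core (i) DISCHARGED at the semi-graph-covering instantiation: distinct connected components of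
`p_i⁻¹(ℍ)` are disjoint.** [cite: Mochizuki2012, Cor 2.3(vi) p.48] -/
theorem toLevelData_compsDisjoint : C.toLevelData.CompsDisjoint := by
  rintro i A ⟨v, hv, rfl⟩ B ⟨w, hw, rfl⟩ ⟨x, hxv, hxw⟩
  exact C.compOf_eq_of_mem i hv hw hxv hxw

/-- **B4 core (ii) DISCHARGED at the semi-graph-covering instantiation: `Π^tp_X` permutes the connected
components of `p_i⁻¹(ℍ)`** (it acts by automorphisms of `𝔾_{J_i}` over `p_i`).
[cite: Mochizuki2012, Cor 2.3 p.47] -/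
theorem toLevelData_compsInvariant : C.toLevelData.CompsInvariant := by
  rintro i t A ⟨v, hv, rfl⟩
  refine ⟨(C.act i t).hom.vertexMap v,
    SemiGraph.preimage_verts_aut (C.proj i) C.H (C.act i t) (C.act_over i t) v hv, ?_⟩
  change (fun u => (C.act i t).hom.vertexMap u) '' C.compOf i v hv = _
  exact C.image_compOf i t v hv

/-- **`ℍ̃_i` is a block of the `Π^tp_X`-action** at the semi-graph-covering instantiation (the carrier's `IsBlock`,
hence the consumer's `blkD`, with no residual hypothesis). [cite: Mochizuki2012, Cor 2.3(vi) p.48] -/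
theorem toLevelData_isBlock : C.toLevelData.IsBlock :=
  C.toLevelData.isBlock_of_comps C.toLevelData_compsDisjoint C.toLevelData_compsInvariant

/-- **B1 (a) at the instantiation**: if `J_i` acts trivially on `𝔾_{J_i}` (the action of `Π^tp_X` on the special
fibre of `X_{J_i}` factors through `Π^tp_X/J_i`), the realised level data satisfies `LevelActsTrivially`.
[cite: Mochizuki2012, Prop 2.4(i) p.50] -/
theorem toLevelData_levelActsTrivially
    (hker : ∀ i, ∀ j ∈ D.levelTp (T.Jhat i), C.act i (j : D.PiTp) = 1) :
    C.toLevelData.LevelActsTrivially := by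
  intro i j hj
  change (SemiGraph.autVertexPerm (C.graph i)).comp (C.act i) (j : D.PiTp) = 1
  rw [MonoidHom.comp_apply, hker i j hj, map_one]

/-- **The `LevelTarget` of the carrier at the instantiation**, with the B4 core no longer a hypothesis: from
base-level Cor. 2.3 (i), B3 `LevelIncidence` and the dictionary B1 (c) `StabLeDeltaHLevel` alone.
[cite: Mochizuki2012, Cor 2.3(vi) p.48] -/
theorem toLevelData_levelTarget (h23i : D.Cor23i) (hinc : C.toLevelData.LevelIncidence)
    (hstab : C.toLevelData.StabLeDeltaHLevel) : T.LevelTarget :=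
  C.toLevelData.levelTarget_of_inputs h23i hinc C.toLevelData_isBlock hstab

end CoveringLevelGraphs

end Prop24Tower

end StableCurveTemperedData

end Literature.IUT.HodgeTheaters
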